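import Summits.NavierStokesRegularity.NavierStokesRegularity.Theorems.TaoLadderRungTwoFlatHopTubeLanding
import HarnessLib

/-!
# ENTRY HAND-OVER 52 — the capture → tube entry hop of `H(n)` (child 2A `GradedAdiabaticWakeA` of the K_A♭ split of
  route TaoLadderRungTwoFlat; cell harvest/h2-tao-ladder, theory-1 g40, numT52; LADDER §52)

PROVENANCE (p1 g22): theory-1 g40's image of record numT52/EntryHandover52.lean sha16 0e05a3a013d73267 (540 l., farm
rc 0 · 0 sorry · 0 warnings), landed with declarations BYTE-IDENTICAL in TWO modules (400-line lint) under the image's own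
namespace `…Theorems.HopTube`: part 1 = this module (pointwise bookkeeping (W)+(T1)+(T2), the pulse section state and (WG)
in section form, R52-1 head-gauge capture); part 2 = `…EntryHandoverLanding` (landing wrappers, entry budgets = order of
constants, flat specialisation). The image's module docstring follows verbatim.

WHAT THIS FILE FIXES. At the ENTRY hop `n = N₀` the premise of every zone obligation (`TubeStepCore/Near/Behind N₀`,
module `…HopTube`) is a CAPTURE state (`CaptureClause`: sup-ball of radius `η N₀` around the canonical checkpoint
state `ζ N₀`, plus `AheadClause`), while the conclusion is the full zone description at `N₀ + 1` (core = GAUGE distance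
on the half-line `k ≥ -K`, near = co-moving block energy, behind = sup envelope). Sup-closeness does NOT convert to
gauge-closeness on the half-line (the gauge `g^{k⁺}` is unbounded ahead), so the entry core clause is assembled from
THREE sources: (W) on the finite window `-K ≤ k < k₁` — sup-closeness `η₁` of the landed state to a reference state
`ref` (the datum solution's checkpoint, by finite-time continuity L3) + gauge-closeness `δ₁` of `ref` to the pulse
family member `x_r·u⋆` (child 1's clause (WG), WINDOW part only) + the anchor-scale mismatch `|x − x_r| ≤ ξ`;
(T1) on the tail `k ≥ k₁` — the landed `AheadClause` (`8·w k·|y| ≤ a·r`) read in the gauge through the domination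
`ω_k·(a r) ≤ 8 δ₂ w_k` (Gaussian `w` beats geometric `ω`; `r = r₁ε₀` makes `δ₂ → 0`); (T2) the pulse's own gauge tail
`ω_k·x·|u⋆ k| ≤ δ₃` beyond `k₁` (doubly-exponential profile decay beats `g^k`; fixes `k₁ ≥ k⋆(δ̄)`, `ε₀`-free).
Kernel-checked here (no `sorry`): the bookkeeping inequalities `gauge_dev_le_of_window_and_tail` (W)+(T1)+(T2) ⇒
`ω·|y − x·u⋆| ≤ max(G η₁ + δ₁ + G ξ M_u, δ₂ + δ₃)` on `k ≥ -K`; `gauge_tail_of_ahead` (T1); the window gauge bound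
`geomGauge_le_pow_of_lt` (`G = g^{k₁⁺}`); the LANDING wrappers `core_landing_of_window_and_tail`,
`near_landing_of_sup`, `behind_landing_of_sup` producing exactly the hypotheses of `coreClause_recentre` /
`nearClause_recentre` / `behindClause_recentre` (module `…HopTubeLanding`); the (WG)-rewriting `gauge_close_sectionState`
(`κ·Φ(0) = x_r · u⋆` with `u⋆ = sectionState A_* i₀ Φ(0)`, `x_r = κ|Φ_{i₀,0}(0)|/A_*`); the budget-order lemma
`entry_window_budget` (given `G, M_u, A_*, ω₀, δ̄`: ONE smallness `t = η₁ = δ₁` achieving the window half of the core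
budget — the order of constants is `K → δ̄ → (δ₁, η₁) → N₀` (from (WG) at `(K + D, δ₁)`) `→ ε₀ ≤ ε_cap(N₀, η₁) ∧ ε_entry(δ̄)`);
and the FLAT specialisation `behindClause_flat_iff` (`ε₀ = 0`: the envelope is the constant `A n` — the same zone lemmas
serve child 1A's (WG) proof, which is the flat tube).

ORDER OF RECORD (LADDER §52.3, TRAP-CANDIDATE #6). The tail shell from which the tube's `AheadClause` holds is
`ε₀`-DEPENDENT, `k₁ = k₁(ε₀) → ∞` (the format's `TailFat` ties the ahead tolerance to the kick radius `r = r(ε₀) → 0`),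
so the window gauge bound `G = g^{k₁(ε₀)⁺}` grows (polylogarithmically in `1/ε₀`). In the first form above the
scale-mismatch term `G·ξ·M_u ⊇ G·δ₁·M_u/(ω₀A_*)` then does NOT vanish as `ε₀ → 0` when `δ₁` is the `ε₀`-free (WG)
tolerance that fixes `N₀`. The forms of record are therefore `gauge_dev_le_of_window_and_tail₂` /
`core_landing_of_window_and_tail₂` (mismatch weighed by the gauge-profile constant `M_ω ≥ ω·|u⋆|`, tail bound on `y`
source-agnostic, two sources combined by `tail_of_two_sources`) and `entry_window_budget₂`, whose quantifier order
`∃ δ₁ > 0, ∀ G > 0, ∃ η₁ > 0, …` records that `δ₁` (hence `N₀`) is chosen before and independently of `G(ε₀)`, and only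
the capture radius `η₁` — which is `O(ε₀)` by finite-time continuity anyway — sees `G`.

HONEST FRAMING: MODEL lattice (graded mirror table on `S♭`); elementary real-number bookkeeping about the cell's typed
induction frame; nothing certified; no item moved; nothing about the Navier–Stokes equations.
-/

noncomputable section

set_option linter.dupNamespace false

namespace Summit.NavierStokesRegularity.NavierStokesRegularity.Theorems.HopTube

open Set Finset Literature.Analysis.FluidPDE Literature.Analysis.FluidPDE.TaoCascade

/-! ## Pointwise bookkeeping: deviation from the scaled reference via an intermediate reference state -/

/-- Triangle bookkeeping: `|y − x·u| ≤ |y − ref| + |ref − x_r·u| + |x − x_r|·|u|`.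
[folklore; cell LADDER §52 (entry hand-over)] -/
theorem abs_dev_le_of_ref (y ref u x xr : ℝ) :
    |y - x * u| ≤ |y - ref| + |ref - xr * u| + |x - xr| * |u| := by
  have e : y - x * u = (y - ref) + (ref - xr * u) + (xr - x) * u := by ring
  have h1 : |(y - ref) + (ref - xr * u) + (xr - x) * u| ≤ |(y - ref) + (ref - xr * u)| + |(xr - x) * u| :=
    abs_add_le _ _
  have h2 : |(y - ref) + (ref - xr * u)| ≤ |y - ref| + |ref - xr * u| := abs_add_le _ _
  have h3 : |(xr - x) * u| = |x - xr| * |u| := by rw [abs_mul, abs_sub_comm xr x]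
  rw [e]; linarith [h1, h2, h3]

/-- **(W)+(T1)+(T2) ⇒ GAUGE DEVIATION ON THE HALF-LINE.** On the window `K ≤ k < k₁`: sup-closeness `η₁` to `ref`,
gauge-closeness `δ₁` of `ref` to `x_r·u`, gauge `≤ G`, `|u| ≤ M_u`, scale mismatch `|x − x_r| ≤ ξ`; on the tail
`k ≥ k₁`: gauge smallness `δ₂` of `y` and `δ₃` of `x·u`. Then `ω·|y − x·u| ≤ max(G η₁ + δ₁ + G ξ M_u, δ₂ + δ₃)` on
`k ≥ K`. [cite: Tao2016AveragedNS, §6.3–6.4 (statement shape of the checkpoint step); cell LADDER §52] -/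
theorem gauge_dev_le_of_window_and_tail {ω y ref u : Fin 2 → ℤ → ℝ} {K k₁ : ℤ}
    {x xr η₁ δ₁ G Mu ξ δ₂ δ₃ : ℝ}
    (hω : ∀ i k, 0 ≤ ω i k)
    (hwin : ∀ (i : Fin 2) (k : ℤ), K ≤ k → k < k₁ → |y i k - ref i k| ≤ η₁)
    (href : ∀ (i : Fin 2) (k : ℤ), K ≤ k → k < k₁ → ω i k * |ref i k - xr * u i k| ≤ δ₁)
    (hG : ∀ (i : Fin 2) (k : ℤ), K ≤ k → k < k₁ → ω i k ≤ G)
    (hMu : ∀ (i : Fin 2) (k : ℤ), K ≤ k → k < k₁ → |u i k| ≤ Mu)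
    (hx : |x - xr| ≤ ξ)
    (hty : ∀ (i : Fin 2) (k : ℤ), k₁ ≤ k → ω i k * |y i k| ≤ δ₂)
    (htu : ∀ (i : Fin 2) (k : ℤ), k₁ ≤ k → ω i k * (|x| * |u i k|) ≤ δ₃) :
    ∀ (i : Fin 2) (k : ℤ), K ≤ k → ω i k * |y i k - x * u i k| ≤ max (G * η₁ + δ₁ + G * (ξ * Mu)) (δ₂ + δ₃) := by
  intro i k hk
  have hω' := hω i k
  by_cases hk1 : k < k₁
  · have h1 := hwin i k hk hk1
    have h2 := href i k hk hk1
    have h3 := hG i k hk hk1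
    have h4 := hMu i k hk hk1
    have hG0 : 0 ≤ G := hω'.trans h3
    have hξ0 : 0 ≤ ξ := (abs_nonneg _).trans hx
    have htri := abs_dev_le_of_ref (y i k) (ref i k) (u i k) x xr
    have t1 : ω i k * |y i k - ref i k| ≤ G * η₁ := mul_le_mul h3 h1 (abs_nonneg _) hG0
    have t3 : ω i k * (|x - xr| * |u i k|) ≤ G * (ξ * Mu) :=
      mul_le_mul h3 (mul_le_mul hx h4 (abs_nonneg _) hξ0) (by positivity) hG0
    calc ω i k * |y i k - x * u i k|
        ≤ ω i k * (|y i k - ref i k| + |ref i k - xr * u i k| + |x - xr| * |u i k|) :=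
          mul_le_mul_of_nonneg_left htri hω'
      _ = ω i k * |y i k - ref i k| + ω i k * |ref i k - xr * u i k| + ω i k * (|x - xr| * |u i k|) := by ring
      _ ≤ G * η₁ + δ₁ + G * (ξ * Mu) := by linarith
      _ ≤ _ := le_max_left _ _
  · have hk1' : k₁ ≤ k := not_lt.mp hk1
    have h1 := hty i k hk1'
    have h2 := htu i k hk1'
    have htri : |y i k - x * u i k| ≤ |y i k| + |x| * |u i k| := by
      calc |y i k - x * u i k| ≤ |y i k| + |x * u i k| := abs_sub _ _
        _ = |y i k| + |x| * |u i k| := by rw [abs_mul]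
    calc ω i k * |y i k - x * u i k| ≤ ω i k * (|y i k| + |x| * |u i k|) := mul_le_mul_of_nonneg_left htri hω'
      _ = ω i k * |y i k| + ω i k * (|x| * |u i k|) := by ring
      _ ≤ δ₂ + δ₃ := add_le_add h1 h2
      _ ≤ _ := le_max_right _ _

/-- **(W)+(T) ⇒ GAUGE DEVIATION, SHARP MISMATCH TERM (the form the `ε₀`-bookkeeping needs).** As
`gauge_dev_le_of_window_and_tail`, but the scale-mismatch term is weighed with the GAUGE-PROFILE constant
`M_ω ≥ ω·|u|` on the window instead of `G·M_u`: `ω·|y − x·u| ≤ max(G η₁ + δ₁ + ξ M_ω, δ₂ + δ₃)` on `k ≥ K`. Here the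
window gauge bound `G = g^{k₁⁺}` multiplies ONLY the capture radius `η₁` (which is `O(ε₀)`), never the `ε₀`-free
(WG) tolerance `δ₁` that fixes `N₀` (in the first form `G·ξ·M_u ⊇ G·δ₁·M_u/(ω₀A_*)` does not vanish as `ε₀ → 0` once
`k₁ = k₁(ε₀) → ∞`; TRAP-CANDIDATE #6, LADDER §52.3). The tail bound `hty` is SOURCE-AGNOSTIC (ahead clause, light cone,
or both via `tail_of_two_sources`). [cite: Tao2016AveragedNS, §6.3–6.4 (statement shape of the checkpoint step); cell LADDER §52] -/
theorem gauge_dev_le_of_window_and_tail₂ {ω y ref u : Fin 2 → ℤ → ℝ} {K k₁ : ℤ}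
    {x xr η₁ δ₁ G Mω ξ δ₂ δ₃ : ℝ}
    (hω : ∀ i k, 0 ≤ ω i k)
    (hwin : ∀ (i : Fin 2) (k : ℤ), K ≤ k → k < k₁ → |y i k - ref i k| ≤ η₁)
    (href : ∀ (i : Fin 2) (k : ℤ), K ≤ k → k < k₁ → ω i k * |ref i k - xr * u i k| ≤ δ₁)
    (hG : ∀ (i : Fin 2) (k : ℤ), K ≤ k → k < k₁ → ω i k ≤ G)
    (hMω : ∀ (i : Fin 2) (k : ℤ), K ≤ k → k < k₁ → ω i k * |u i k| ≤ Mω)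
    (hx : |x - xr| ≤ ξ)
    (hty : ∀ (i : Fin 2) (k : ℤ), k₁ ≤ k → ω i k * |y i k| ≤ δ₂)
    (htu : ∀ (i : Fin 2) (k : ℤ), k₁ ≤ k → ω i k * (|x| * |u i k|) ≤ δ₃) :
    ∀ (i : Fin 2) (k : ℤ), K ≤ k → ω i k * |y i k - x * u i k| ≤ max (G * η₁ + δ₁ + ξ * Mω) (δ₂ + δ₃) := by
  intro i k hk
  have hω' := hω i k
  by_cases hk1 : k < k₁
  · have h1 := hwin i k hk hk1
    have h2 := href i k hk hk1
    have h3 := hG i k hk hk1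
    have h4 := hMω i k hk hk1
    have hG0 : 0 ≤ G := hω'.trans h3
    have hξ0 : 0 ≤ ξ := (abs_nonneg _).trans hx
    have htri := abs_dev_le_of_ref (y i k) (ref i k) (u i k) x xr
    have t1 : ω i k * |y i k - ref i k| ≤ G * η₁ := mul_le_mul h3 h1 (abs_nonneg _) hG0
    have t3 : ω i k * (|x - xr| * |u i k|) ≤ ξ * Mω := by
      have e : ω i k * (|x - xr| * |u i k|) = |x - xr| * (ω i k * |u i k|) := by ring
      rw [e]
      exact mul_le_mul hx h4 (mul_nonneg hω' (abs_nonneg _)) hξ0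
    calc ω i k * |y i k - x * u i k|
        ≤ ω i k * (|y i k - ref i k| + |ref i k - xr * u i k| + |x - xr| * |u i k|) :=
          mul_le_mul_of_nonneg_left htri hω'
      _ = ω i k * |y i k - ref i k| + ω i k * |ref i k - xr * u i k| + ω i k * (|x - xr| * |u i k|) := by ring
      _ ≤ G * η₁ + δ₁ + ξ * Mω := by linarith
      _ ≤ _ := le_max_left _ _
  · have hk1' : k₁ ≤ k := not_lt.mp hk1
    have h1 := hty i k hk1'
    have h2 := htu i k hk1'
    have htri : |y i k - x * u i k| ≤ |y i k| + |x| * |u i k| := by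
      calc |y i k - x * u i k| ≤ |y i k| + |x * u i k| := abs_sub _ _
        _ = |y i k| + |x| * |u i k| := by rw [abs_mul]
    calc ω i k * |y i k - x * u i k| ≤ ω i k * (|y i k| + |x| * |u i k|) := mul_le_mul_of_nonneg_left htri hω'
      _ = ω i k * |y i k| + ω i k * (|x| * |u i k|) := by ring
      _ ≤ δ₂ + δ₃ := add_le_add h1 h2
      _ ≤ _ := le_max_right _ _

/-- **TWO TAIL SOURCES.** A gauge bound `δ_m` on a middle range `k_w ≤ k < k_f` (e.g. the energy light cone of the
datum solution at the finite entry time, `…DatumLightCone`, uniform in `ε₀` on a finite range) and `δ_f` on the far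
range `k ≥ k_f` (e.g. the landed ahead clause read in the gauge, `gauge_tail_of_ahead`, from the `ε₀`-dependent tail
shell `k_f = k₁(ε₀)` on) combine to `max δ_m δ_f` from `k_w` on. [folklore; cell LADDER §52.3] -/
theorem tail_of_two_sources {ω y : Fin 2 → ℤ → ℝ} {kw kf : ℤ} {δm δf : ℝ}
    (hmid : ∀ (i : Fin 2) (k : ℤ), kw ≤ k → k < kf → ω i k * |y i k| ≤ δm)
    (hfar : ∀ (i : Fin 2) (k : ℤ), kf ≤ k → ω i k * |y i k| ≤ δf) :
    ∀ (i : Fin 2) (k : ℤ), kw ≤ k → ω i k * |y i k| ≤ max δm δf := by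
  intro i k hk
  by_cases h : k < kf
  · exact (hmid i k hk h).trans (le_max_left _ _)
  · exact (hfar i k (not_lt.mp h)).trans (le_max_right _ _)

/-- **(T1) THE AHEAD CLAUSE READ IN THE GAUGE.** From `8·(w k·|y|) ≤ R` beyond `k₁` and the weight domination
`ω_{i,k}·R ≤ 8 δ₂ w_k` there: `ω·|y| ≤ δ₂` beyond `k₁` (Gaussian `w` vs geometric `ω`; with `R = a·r`, `r = r₁ε₀` the
domination holds for `ε₀ ≤ ε_entry(δ₂)`). [cite: Tao2016AveragedNS, §6.2 Prop. 6.3 (ix) (tail clause shape); cell LADDER §52] -/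
theorem gauge_tail_of_ahead {ω y : Fin 2 → ℤ → ℝ} {w : ℤ → ℝ} {k₁ : ℤ} {R δ₂ : ℝ}
    (hω : ∀ i k, 0 ≤ ω i k) (hw : ∀ k, 0 < w k)
    (hahead : ∀ (i : Fin 2) (k : ℤ), k₁ ≤ k → 8 * (w k * |y i k|) ≤ R)
    (hdom : ∀ (i : Fin 2) (k : ℤ), k₁ ≤ k → ω i k * R ≤ 8 * δ₂ * w k) :
    ∀ (i : Fin 2) (k : ℤ), k₁ ≤ k → ω i k * |y i k| ≤ δ₂ := by
  intro i k hk
  have h1 := hahead i k hk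
  have h2 := hdom i k hk
  have hwk := hw k
  have h8 : (0 : ℝ) < 8 * w k := by positivity
  have h3 : |y i k| ≤ R / (8 * w k) := by
    rw [le_div_iff₀ h8]
    have e : |y i k| * (8 * w k) = 8 * (w k * |y i k|) := by ring
    rw [e]; exact h1
  calc ω i k * |y i k| ≤ ω i k * (R / (8 * w k)) := mul_le_mul_of_nonneg_left h3 (hω i k)
    _ = ω i k * R / (8 * w k) := by ring
    _ ≤ δ₂ := by
        rw [div_le_iff₀ h8]
        have e : δ₂ * (8 * w k) = 8 * δ₂ * w k := by ring
        rw [e]; exact h2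

/-- **THE WINDOW GAUGE BOUND** `G = g^{k₁⁺}`: below `k₁` the geometric gauge is at most `g^{k₁⁺}` (`g, b ≥ 1`).
[folklore; cell LADDER §52] -/
theorem geomGauge_le_pow_of_lt {g b : ℝ} (hg : 1 ≤ g) (hb : 1 ≤ b) (i : Fin 2) {k k₁ : ℤ} (hk : k < k₁) :
    MirrorPulse.geomGauge g b i k ≤ g ^ k₁.toNat := by
  have h1 := MirrorPulse.geomGauge_le_headGauge (le_trans zero_le_one hg) hb i k
  refine h1.trans ?_
  unfold MirrorPulse.headGauge
  exact pow_le_pow_right₀ hg (Int.toNat_le_toNat hk.le)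

/-! ## The pulse section state and child 1's clause (WG) in the frame's vocabulary -/

/-- The NORMALISED SECTION STATE `u⋆ = (A_*/|Φ₀ i₀ 0|)·Φ₀` of a profile `Φ₀` (so `|u⋆ i₀ 0| = A_*`).
[cite: Tao2016AveragedNS, §6.3 (modulation/normalisation, statement shape); cell LADDER §50 (CoreClause), §52] -/
def sectionState (Astar : ℝ) (i₀ : Fin 2) (Φ₀ : Fin 2 → ℤ → ℝ) : Fin 2 → ℤ → ℝ :=
  fun i k => Astar / |Φ₀ i₀ 0| * Φ₀ i k

/-- The section state is anchored: `|u⋆ i₀ 0| = A_*` (`A_* ≥ 0`, `Φ₀ i₀ 0 ≠ 0`). [folklore; cell LADDER §52] -/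
theorem abs_sectionState_anchor {Astar : ℝ} (hA : 0 ≤ Astar) {i₀ : Fin 2} {Φ₀ : Fin 2 → ℤ → ℝ}
    (h0 : Φ₀ i₀ 0 ≠ 0) : |sectionState Astar i₀ Φ₀ i₀ 0| = Astar := by
  unfold sectionState
  rw [abs_mul, abs_div, abs_abs, abs_of_nonneg hA, div_mul_cancel₀ _ (abs_ne_zero.mpr h0)]

/-- The scaled pulse profile is a member of the `u⋆`-family: `κ·Φ₀ = x_r·u⋆` with `x_r = κ|Φ₀ i₀ 0|/A_*`.
[folklore; cell LADDER §52] -/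
theorem refScale_mul_sectionState {Astar κ : ℝ} (hA : Astar ≠ 0) {i₀ : Fin 2} {Φ₀ : Fin 2 → ℤ → ℝ}
    (h0 : Φ₀ i₀ 0 ≠ 0) (i : Fin 2) (k : ℤ) :
    κ * |Φ₀ i₀ 0| / Astar * sectionState Astar i₀ Φ₀ i k = κ * Φ₀ i k := by
  unfold sectionState
  have h1 : |Φ₀ i₀ 0| ≠ 0 := abs_ne_zero.mpr h0
  field_simp

/-- **(WG) REWRITTEN.** A gauge-closeness statement to `κ·Φ₀` (child 1's clause (WG) at one checkpoint, any index
range) is a gauge-closeness statement to `x_r·u⋆` — the `href` input of `gauge_dev_le_of_window_and_tail`.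
[cite: Tao2016AveragedNS, §6.2 Prop. 6.3 (checkpoint description, statement shape); cell LADDER §52] -/
theorem gauge_close_sectionState {Astar κ δ : ℝ} (hA : Astar ≠ 0) {i₀ : Fin 2} {Φ₀ : Fin 2 → ℤ → ℝ}
    (h0 : Φ₀ i₀ 0 ≠ 0) {ω ref : Fin 2 → ℤ → ℝ} {p : ℤ → Prop}
    (h : ∀ (i : Fin 2) (k : ℤ), p k → ω i k * |ref i k - κ * Φ₀ i k| ≤ δ) :
    ∀ (i : Fin 2) (k : ℤ), p k →
      ω i k * |ref i k - κ * |Φ₀ i₀ 0| / Astar * sectionState Astar i₀ Φ₀ i k| ≤ δ := by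
  intro i k hk
  rw [refScale_mul_sectionState hA h0 i k]
  exact h i k hk

/-- **(T2) FROM (WG)∞.** The pulse's own gauge tail is controlled by child 1's HALF-LINE clause (WG) together with
the gauge smallness of the datum solution's far-ahead shells at the (finite) checkpoint time (light cone,
`…TailEnergy`): `ω·|κΦ₀| ≤ ω·|ref| + ω·|ref − κΦ₀| ≤ δ₂' + δ` beyond `k₁`. This is where the half-line surplus of
(WG) over the window form is consumed. [cite: Tao2016AveragedNS, §6.2 Prop. 6.3 (ix) (tail clause shape); cell LADDER §52] -/
theorem pulse_gauge_tail_of_ref {ω ref Φ₀ : Fin 2 → ℤ → ℝ} {κ δ δ₂' : ℝ} {k₁ : ℤ}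
    (hω : ∀ i k, 0 ≤ ω i k)
    (hWG : ∀ (i : Fin 2) (k : ℤ), k₁ ≤ k → ω i k * |ref i k - κ * Φ₀ i k| ≤ δ)
    (hcone : ∀ (i : Fin 2) (k : ℤ), k₁ ≤ k → ω i k * |ref i k| ≤ δ₂') :
    ∀ (i : Fin 2) (k : ℤ), k₁ ≤ k → ω i k * |κ * Φ₀ i k| ≤ δ₂' + δ := by
  intro i k hk
  have h1 := hWG i k hk
  have h2 := hcone i k hk
  have htri : |κ * Φ₀ i k| ≤ |ref i k| + |ref i k - κ * Φ₀ i k| := by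
    have h := abs_sub_abs_le_abs_sub (ref i k) (κ * Φ₀ i k)
    have h' : |ref i k| - |κ * Φ₀ i k| ≥ -|ref i k - κ * Φ₀ i k| := by
      have := abs_sub_abs_le_abs_sub (κ * Φ₀ i k) (ref i k)
      rw [abs_sub_comm (κ * Φ₀ i k) (ref i k)] at this
      linarith
    linarith
  calc ω i k * |κ * Φ₀ i k| ≤ ω i k * (|ref i k| + |ref i k - κ * Φ₀ i k|) :=
        mul_le_mul_of_nonneg_left htri (hω i k)
    _ = ω i k * |ref i k| + ω i k * |ref i k - κ * Φ₀ i k| := by ring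
    _ ≤ δ₂' + δ := add_le_add h2 h1

/-- The anchor-scale mismatch from the anchor coordinate: `|(|y₀|/A_*) − κ|Φ₀ i₀ 0|/A_*| ≤ (η₁ + δ₁/ω₀)/A_*` when
`|y₀ − ref₀| ≤ η₁`, `ω₀·|ref₀ − κΦ₀ i₀ 0| ≤ δ₁`, `ω₀ > 0`, `κ ≥ 0`. [folklore; cell LADDER §52] -/
theorem anchorScale_mismatch_le {Astar κ η₁ δ₁ ω₀ y₀ ref₀ Φ₀₀ : ℝ} (hA : 0 < Astar) (hκ : 0 ≤ κ) (hω₀ : 0 < ω₀)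
    (hy : |y₀ - ref₀| ≤ η₁) (hr : ω₀ * |ref₀ - κ * Φ₀₀| ≤ δ₁) :
    abs (|y₀| / Astar - κ * |Φ₀₀| / Astar) ≤ (η₁ + δ₁ / ω₀) / Astar := by
  have h1 : |ref₀ - κ * Φ₀₀| ≤ δ₁ / ω₀ := by
    rw [le_div_iff₀ hω₀]; linarith [mul_comm ω₀ |ref₀ - κ * Φ₀₀|]
  have h2 : |y₀ - κ * Φ₀₀| ≤ η₁ + δ₁ / ω₀ := by
    calc |y₀ - κ * Φ₀₀| = |(y₀ - ref₀) + (ref₀ - κ * Φ₀₀)| := by ring_nf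
      _ ≤ |y₀ - ref₀| + |ref₀ - κ * Φ₀₀| := abs_add_le _ _
      _ ≤ η₁ + δ₁ / ω₀ := add_le_add hy h1
  have h3 : abs (|y₀| - κ * |Φ₀₀|) ≤ η₁ + δ₁ / ω₀ := by
    have e : κ * |Φ₀₀| = |κ * Φ₀₀| := by rw [abs_mul, abs_of_nonneg hκ]
    rw [e]
    exact (abs_abs_sub_abs_le_abs_sub _ _).trans h2
  have e2 : |y₀| / Astar - κ * |Φ₀₀| / Astar = (|y₀| - κ * |Φ₀₀|) / Astar := by ring
  rw [e2, abs_div, abs_of_pos hA]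
  exact div_le_div_of_nonneg_right h3 hA.le

/-! ## R52-1 — capture in the HEAD GAUGE: the entry core with NO window/tail split (LADDER §52.4)

If the capture phase is typed in the head gauge `g^{k⁺}` (`MirrorPulse.headGauge`, `≥ 1`, `≥ ω`) instead of the
sup norm — i.e. `CaptureClause` reads `headGauge g i k · |z i k − ζ n i k| ≤ η n` — then at the entry hop the
capture radius converts to the contraction gauge for free on the WHOLE half-line, and the entry core budget is
`η₁ + δ₁ + ξ·M_ω ≤ a·δ(N₀+1)` with every constant `ε₀`-free except `η₁ = O(ε₀)`: no window gauge bound `G(ε₀)`, no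
tail shell, no (T1)/(T2). (Finite-time continuity in the `g^{k⁺}`-weighted sup norm costs a factor `g` in the
Lipschitz constant, nothing else — memo ENTRY-HANDOVER-52 §4.) -/

/-- Capture closeness in the head gauge `g^{k⁺}` gives closeness in the contraction gauge `ω = g^{k⁺} b^{−k⁻} ≤ g^{k⁺}`.
[folklore; tree `MirrorPulse.geomGauge_le_headGauge`; cell LADDER §52.4] -/
theorem gauge_capture_of_headGauge {g b : ℝ} (hg : 0 ≤ g) (hb : 1 ≤ b) {y ref : Fin 2 → ℤ → ℝ} {K : ℤ} {η : ℝ}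
    (h : ∀ (i : Fin 2) (k : ℤ), K ≤ k → MirrorPulse.headGauge g i k * |y i k - ref i k| ≤ η) :
    ∀ (i : Fin 2) (k : ℤ), K ≤ k → MirrorPulse.geomGauge g b i k * |y i k - ref i k| ≤ η := fun i k hk =>
  (mul_le_mul_of_nonneg_right (MirrorPulse.geomGauge_le_headGauge hg hb i k) (abs_nonneg _)).trans (h i k hk)

/-- **GAUGE CAPTURE ⇒ GAUGE DEVIATION on the half-line** (no split): `ω·|y − x·u| ≤ η₁ + δ₁ + ξ·M_ω` on `k ≥ K` from
gauge-closeness `η₁` of `y` to `ref`, gauge-closeness `δ₁` of `ref` to `x_r·u` ((WG)), the gauge-profile constant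
`M_ω` and the scale mismatch `ξ`. [cite: Tao2016AveragedNS, §6.3–6.4 (statement shape of the checkpoint step); cell LADDER §52.4] -/
theorem gauge_dev_le_of_gauge_capture {ω y ref u : Fin 2 → ℤ → ℝ} {K : ℤ} {x xr η₁ δ₁ Mω ξ : ℝ}
    (hω : ∀ i k, 0 ≤ ω i k)
    (hcap : ∀ (i : Fin 2) (k : ℤ), K ≤ k → ω i k * |y i k - ref i k| ≤ η₁)
    (href : ∀ (i : Fin 2) (k : ℤ), K ≤ k → ω i k * |ref i k - xr * u i k| ≤ δ₁)
    (hMω : ∀ (i : Fin 2) (k : ℤ), K ≤ k → ω i k * |u i k| ≤ Mω)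
    (hx : |x - xr| ≤ ξ) :
    ∀ (i : Fin 2) (k : ℤ), K ≤ k → ω i k * |y i k - x * u i k| ≤ η₁ + δ₁ + ξ * Mω := by
  intro i k hk
  have hω' := hω i k
  have h1 := hcap i k hk
  have h2 := href i k hk
  have h4 := hMω i k hk
  have hξ0 : 0 ≤ ξ := (abs_nonneg _).trans hx
  have htri := abs_dev_le_of_ref (y i k) (ref i k) (u i k) x xr
  have t3 : ω i k * (|x - xr| * |u i k|) ≤ ξ * Mω := by
    have e : ω i k * (|x - xr| * |u i k|) = |x - xr| * (ω i k * |u i k|) := by ring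
    rw [e]
    exact mul_le_mul hx h4 (mul_nonneg hω' (abs_nonneg _)) hξ0
  calc ω i k * |y i k - x * u i k|
      ≤ ω i k * (|y i k - ref i k| + |ref i k - xr * u i k| + |x - xr| * |u i k|) :=
        mul_le_mul_of_nonneg_left htri hω'
    _ = ω i k * |y i k - ref i k| + ω i k * |ref i k - xr * u i k| + ω i k * (|x - xr| * |u i k|) := by ring
    _ ≤ η₁ + δ₁ + ξ * Mω := by linarith

end Summit.NavierStokesRegularity.NavierStokesRegularity.Theorems.HopTube

end
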